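import Summits.Ventures.LatticeQCDFlow.Scoring.TorusPartitionFunctionContinuumLimit
import Summits.Ventures.LatticeQCDFlow.Scoring.U1TorusWilsonLoops
import HarnessLib

/-!
# The continuum limit of the `U(1)` Wilson loops on the torus

HONEST FRAMING: exact (Metropolis-corrected) sampling algorithms for lattice gauge theory;
figures of merit are autocorrelation/cost numbers at stated couplings and volumes; no
continuum-physics claim.

Venture `LatticeQCDFlow` (cell pub-lqcd), sub-topic `Scoring`; FANOUT row 5 (`s0-sun-a`), GEN-15.
NEW WORK of the cell (placement rule).  `Scoring/U1TorusWilsonLoops.lean` typed the exact `U(1)`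
Wilson loop of the boundary of any set `A` of plaquettes of the `L₁ × L₂` torus (`a = #A`, `V = L₁L₂`):
`⟨cos θ(∂A)⟩ = Σ_k I_{|k|}^{V−a}(I_{|k−1|}^a + I_{|k+1|}^a)/2 / Σ_k I_{|k|}^V` (all at coupling `β`).
Normalising by `I₀^V` and using the power limits of `Scoring/BesselIRatioPowerLimit.lean`
(`(I_{|m|}(β_j)/I₀(β_j))^{C_j} → e^{−c m²/2}` when `C_j/β_j → c`):

* `tendsto_tsum_u1_loop_terms` — dominated convergence of the normalised numerator (each term is at
  most `r_k^V` or `r_{k∓1}^V`, `r_m = I_{|m|}/I₀`, whichever ratio is larger — no monotonicity needed —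
  with the geometric majorant from Amos' Gaussian bound);
* **`tendsto_torus_u1WilsonExpect_cos_boundary`** — **THE CONTINUUM LIMIT**: along any sequence of
  tori and regions with `β_j → ∞`, `#A_j/β_j → a`, `L₁L₂/β_j → v > 0`,
  `⟨cos θ(∂A_j)⟩ → Σ_{k∈ℤ} e^{−(v−a)k²/2}(e^{−a(k−1)²/2} + e^{−a(k+1)²/2})/2 / Σ_{k∈ℤ} e^{−vk²/2}`
  — the genus-one abelian formula (charge `k` outside, `k ± 1` inside the loop, Casimir `k²/2`);
  at `a = 0` it is `1`, and as `v → ∞` it tends to the plane area law `e^{−a/2}`.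

Elementary given the parents; nothing is cited.  No sampler values.
-/

noncomputable section

open Real Filter Topology Set MeasureTheory Finset
open scoped ENNReal
open Literature.Analysis.FunctionSpaces

namespace Summit.Ventures.LatticeQCDFlow.Scoring

/-! ### 1. The normalised numerator -/

/-- `(I_{|m|}(β_j)/I₀(β_j))^{C_j} → e^{−c m²/2}` when `β_j → ∞`, `C_j/β_j → c` (`m ∈ ℤ`). -/
theorem tendsto_besselI_natAbs_ratio_pow {β : ℕ → ℝ} {C : ℕ → ℕ} {c : ℝ} (hβ : Tendsto β atTop atTop)
    (hc : Tendsto (fun j => (C j : ℝ) / β j) atTop (𝓝 c)) (m : ℤ) :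
    Tendsto (fun j => (besselI m.natAbs (β j) / besselI 0 (β j)) ^ C j) atTop
      (𝓝 (Real.exp (-(c * (m : ℝ) ^ 2 / 2)))) := by
  have h := tendsto_besselI_ratio_pow hβ hc 0 m.natAbs
  have e : c * ((m.natAbs : ℝ) * (2 * ((0 : ℕ) : ℝ) + (m.natAbs : ℝ)) / 2) = c * (m : ℝ) ^ 2 / 2 := by
    rw [Nat.cast_zero, mul_zero, zero_add, Nat.cast_natAbs, Int.cast_abs, abs_mul_abs_self]; ring
  simpa only [zero_add, e] using h

/-- **Numerator**: for `β_j → ∞`, `a_j ≤ V_j`, `a_j/β_j → a`, `V_j/β_j → v > 0`,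
`Σ_k r_k^{V_j−a_j}(r_{k−1}^{a_j} + r_{k+1}^{a_j})/2 → Σ_k e^{−(v−a)k²/2}(e^{−a(k−1)²/2} + e^{−a(k+1)²/2})/2`
(`r_m = I_{|m|}(β_j)/I₀(β_j)`). -/
theorem tendsto_tsum_u1_loop_terms {β : ℕ → ℝ} {A V : ℕ → ℕ} {a v : ℝ} (hv0 : 0 < v)
    (hβ : Tendsto β atTop atTop) (hAV : ∀ j, A j ≤ V j)
    (ha : Tendsto (fun j => (A j : ℝ) / β j) atTop (𝓝 a))
    (hv : Tendsto (fun j => (V j : ℝ) / β j) atTop (𝓝 v)) :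
    Tendsto (fun j => ∑' k : ℤ, (besselI k.natAbs (β j) / besselI 0 (β j)) ^ (V j - A j) *
        (((besselI (k - 1).natAbs (β j) / besselI 0 (β j)) ^ A j +
          (besselI (k + 1).natAbs (β j) / besselI 0 (β j)) ^ A j) / 2)) atTop
      (𝓝 (∑' k : ℤ, Real.exp (-((v - a) * (k : ℝ) ^ 2 / 2)) *
        ((Real.exp (-(a * ((k : ℝ) - 1) ^ 2 / 2)) + Real.exp (-(a * ((k : ℝ) + 1) ^ 2 / 2))) / 2))) := by
  have hd : Tendsto (fun j => ((V j - A j : ℕ) : ℝ) / β j) atTop (𝓝 (v - a)) := by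
    refine (hv.sub ha).congr fun j => ?_
    rw [Nat.cast_sub (hAV j), sub_div]
  -- termwise limits
  have hlim : ∀ k : ℤ, Tendsto (fun j => (besselI k.natAbs (β j) / besselI 0 (β j)) ^ (V j - A j) *
      (((besselI (k - 1).natAbs (β j) / besselI 0 (β j)) ^ A j +
        (besselI (k + 1).natAbs (β j) / besselI 0 (β j)) ^ A j) / 2)) atTop
      (𝓝 (Real.exp (-((v - a) * (k : ℝ) ^ 2 / 2)) *
        ((Real.exp (-(a * ((k : ℝ) - 1) ^ 2 / 2)) + Real.exp (-(a * ((k : ℝ) + 1) ^ 2 / 2))) / 2))) := by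
    intro k
    have h0 := tendsto_besselI_natAbs_ratio_pow hβ hd k
    have h1 := tendsto_besselI_natAbs_ratio_pow hβ ha (k - 1)
    have h2 := tendsto_besselI_natAbs_ratio_pow hβ ha (k + 1)
    push_cast at h1 h2
    exact h0.mul ((h1.add h2).div_const 2)
  -- domination
  set c := min (v / 2 / 4) (1 / 2) with hc
  have hc0 : 0 < c := lt_min (by positivity) (by norm_num)
  refine tendsto_tsum_of_dominated_convergence
    (bound := fun k : ℤ => (Real.exp c * Real.exp c) * Real.exp (-(c * (k.natAbs : ℝ)))) ?_ hlim ?_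
  · exact (summable_exp_neg_mul_natAbs hc0).mul_left _
  · filter_upwards [eventually_continuumLimit_bounds hv0 hβ hv] with j hj k
    obtain ⟨hj0, hlo, -, h2⟩ := hj
    have hI0 : 0 < besselI 0 (β j) := besselI_pos 0 hj0
    set r : ℤ → ℝ := fun m => besselI m.natAbs (β j) / besselI 0 (β j) with hr
    have hr0 : ∀ m, 0 ≤ r m := fun m => div_nonneg (besselI_pos _ hj0).le hI0.le
    have hpow : ∀ m : ℤ, r m ^ V j ≤ Real.exp c * Real.exp (-(c * (m.natAbs : ℝ))) := fun m =>
      besselI_ratio_zero_pow_le hj0 (by positivity) hlo h2 m.natAbs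
    -- `e^{−c|m|} ≤ e^{c} e^{−c|k|}` for `m = k ± 1`
    have hshift : ∀ m : ℤ, (m = k - 1 ∨ m = k + 1) →
        Real.exp (-(c * (m.natAbs : ℝ))) ≤ Real.exp c * Real.exp (-(c * (k.natAbs : ℝ))) := by
      intro m hm
      rw [← Real.exp_add]
      refine Real.exp_le_exp.2 ?_
      have : (k.natAbs : ℝ) ≤ (m.natAbs : ℝ) + 1 := by
        have h : k.natAbs ≤ m.natAbs + 1 := by rcases hm with rfl | rfl <;> omega
        exact_mod_cast h
      nlinarith
    have hAVj := hAV j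
    -- each of the two products is at most `r_k^V` or `r_{k∓1}^V`
    have hprod : ∀ m : ℤ, (m = k - 1 ∨ m = k + 1) →
        r k ^ (V j - A j) * r m ^ A j ≤ Real.exp c * Real.exp c * Real.exp (-(c * (k.natAbs : ℝ))) := by
      intro m hm
      have hec : 1 ≤ Real.exp c := Real.one_le_exp hc0.le
      rcases le_total (r m) (r k) with hmk | hkm
      · calc r k ^ (V j - A j) * r m ^ A j ≤ r k ^ (V j - A j) * r k ^ A j :=
              mul_le_mul_of_nonneg_left (pow_le_pow_left₀ (hr0 m) hmk _) (pow_nonneg (hr0 k) _)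
          _ = r k ^ V j := by rw [← pow_add, Nat.sub_add_cancel hAVj]
          _ ≤ Real.exp c * Real.exp (-(c * (k.natAbs : ℝ))) := hpow k
          _ ≤ Real.exp c * Real.exp c * Real.exp (-(c * (k.natAbs : ℝ))) := by
              rw [mul_assoc]
              exact le_mul_of_one_le_left (by positivity) hec
      · calc r k ^ (V j - A j) * r m ^ A j ≤ r m ^ (V j - A j) * r m ^ A j :=
              mul_le_mul_of_nonneg_right (pow_le_pow_left₀ (hr0 k) hkm _) (pow_nonneg (hr0 m) _)
          _ = r m ^ V j := by rw [← pow_add, Nat.sub_add_cancel hAVj]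
          _ ≤ Real.exp c * Real.exp (-(c * (m.natAbs : ℝ))) := hpow m
          _ ≤ Real.exp c * (Real.exp c * Real.exp (-(c * (k.natAbs : ℝ)))) :=
              mul_le_mul_of_nonneg_left (hshift m hm) (by positivity)
          _ = _ := by ring
    have hA1 := pow_nonneg (hr0 (k - 1)) (A j)
    have hA2 := pow_nonneg (hr0 (k + 1)) (A j)
    have hterm0 : 0 ≤ r k ^ (V j - A j) * ((r (k - 1) ^ A j + r (k + 1) ^ A j) / 2) :=
      mul_nonneg (pow_nonneg (hr0 k) _) (div_nonneg (add_nonneg hA1 hA2) (by norm_num))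
    simp only [hr] at hterm0 hprod ⊢
    rw [Real.norm_of_nonneg hterm0]
    have t1 := hprod (k - 1) (Or.inl rfl)
    have t2 := hprod (k + 1) (Or.inr rfl)
    nlinarith [t1, t2]

/-! ### 2. The continuum limit of the Wilson loop -/

/-- **THE CONTINUUM LIMIT OF THE `U(1)` WILSON LOOPS ON THE TORUS.**  For tori `L₁(j) × L₂(j)`
(links enumerated by `e j`), regions `A_j` and couplings `β_j → ∞` with `#A_j/β_j → a` and
`L₁L₂/β_j → v > 0`, the Wilson loop of `∂A_j` under the `U(1)` Wilson law
(`Scoring/U1TorusWilsonLoops.lean`) converges to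
`Σ_k e^{−(v−a)k²/2}(e^{−a(k−1)²/2} + e^{−a(k+1)²/2})/2 / Σ_k e^{−vk²/2}`. -/
theorem tendsto_torus_u1WilsonExpect_cos_boundary {L₁ L₂ n : ℕ → ℕ} [h₁ : ∀ j, NeZero (L₁ j)]
    [h₂ : ∀ j, NeZero (L₂ j)] (e : ∀ j, Fin 2 × (Fin (L₁ j) × Fin (L₂ j)) ≃ Fin (n j + 1))
    (A : ∀ j, Finset (Fin (L₁ j) × Fin (L₂ j))) {β : ℕ → ℝ} {a v : ℝ} (hv0 : 0 < v)
    (hβ : Tendsto β atTop atTop) (ha : Tendsto (fun j => ((A j).card : ℝ) / β j) atTop (𝓝 a))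
    (hv : Tendsto (fun j => ((L₁ j * L₂ j : ℕ) : ℝ) / β j) atTop (𝓝 v)) :
    Tendsto (fun j => u1WilsonExpect univ (torusInc (e j)) (fun _ => β j)
        (fun θ => Real.cos (∑ l, (boundaryChain (torusInc (e j)) (A j) l : ℝ) * θ l))) atTop
      (𝓝 ((∑' k : ℤ, Real.exp (-((v - a) * (k : ℝ) ^ 2 / 2)) *
          ((Real.exp (-(a * ((k : ℝ) - 1) ^ 2 / 2)) + Real.exp (-(a * ((k : ℝ) + 1) ^ 2 / 2))) / 2)) /
        ∑' k : ℤ, Real.exp (-(v * (k : ℝ) ^ 2 / 2)))) := by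
  have hAV : ∀ j, (A j).card ≤ L₁ j * L₂ j := fun j => by
    have := Finset.card_le_univ (A j)
    simpa [Fintype.card_prod, Fintype.card_fin] using this
  have hnum := tendsto_tsum_u1_loop_terms hv0 hβ hAV ha hv
  have hden := tendsto_tsum_besselI_ratio_pow hv0 hβ hv
  have hDpos : 0 < ∑' k : ℤ, Real.exp (-(v * (k : ℝ) ^ 2 / 2)) := by
    have h := tsum_exp_neg_mul_sq_div_two hv0
    have hsum : Summable fun k : ℤ => Real.exp (-(v * (k : ℝ) ^ 2 / 2)) := by
      refine Summable.of_nonneg_of_le (fun k => (Real.exp_pos _).le) (fun k => ?_)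
        (summable_exp_neg_mul_natAbs (by positivity : 0 < v / 2))
      refine Real.exp_le_exp.2 ?_
      rw [Nat.cast_natAbs, Int.cast_abs]
      have : |(k : ℝ)| ≤ (k : ℝ) ^ 2 := by
        rw [← sq_abs]
        rcases eq_or_ne k 0 with rfl | hk
        · simp
        · have h1 : (1 : ℝ) ≤ |(k : ℝ)| := by
            rw [← Int.cast_abs]; exact_mod_cast Int.one_le_abs hk
          nlinarith
      nlinarith
    exact hsum.tsum_pos (fun k => (Real.exp_pos _).le) 0 (Real.exp_pos _)
  refine (hnum.div hden hDpos.ne').congr' ?_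
  filter_upwards [hβ.eventually_gt_atTop 0] with j hj
  simp only [Pi.div_apply]
  rw [torus_u1WilsonExpect_cos_boundary (e j) (β j) (A j)]
  have hI0 : 0 < besselI 0 (β j) := besselI_pos 0 hj
  set I0 := besselI 0 (β j) with hI0d
  set V := L₁ j * L₂ j with hVd
  set aa := (A j).card with haa
  have hAVj : aa ≤ V := hAV j
  -- numerator: pull out `I₀^V`
  have hN : ∀ k : ℤ, besselI k.natAbs (β j) ^ (V - aa) *
      ((besselI (k - 1).natAbs (β j) ^ aa + besselI (k + 1).natAbs (β j) ^ aa) / 2) =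
      I0 ^ V * ((besselI k.natAbs (β j) / I0) ^ (V - aa) *
        (((besselI (k - 1).natAbs (β j) / I0) ^ aa + (besselI (k + 1).natAbs (β j) / I0) ^ aa) / 2)) := by
    intro k
    have hV : I0 ^ V = I0 ^ (V - aa) * I0 ^ aa := by rw [← pow_add, Nat.sub_add_cancel hAVj]
    rw [hV, div_pow, div_pow, div_pow]
    field_simp
  have hD : ∀ k : ℤ, besselI k.natAbs (β j) ^ V = I0 ^ V * (besselI k.natAbs (β j) / I0) ^ V := by
    intro k
    rw [div_pow, mul_div_cancel₀ _ (pow_ne_zero _ hI0.ne')]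
  have hNum : (∑' k : ℤ, besselI k.natAbs (β j) ^ (V - aa) *
      ((besselI (k - 1).natAbs (β j) ^ aa + besselI (k + 1).natAbs (β j) ^ aa) / 2)) =
      I0 ^ V * ∑' k : ℤ, (besselI k.natAbs (β j) / I0) ^ (V - aa) *
        (((besselI (k - 1).natAbs (β j) / I0) ^ aa + (besselI (k + 1).natAbs (β j) / I0) ^ aa) / 2) := by
    rw [← tsum_mul_left]; exact tsum_congr hN
  have hDen : (∑' k : ℤ, besselI k.natAbs (β j) ^ V) = I0 ^ V * ∑' k : ℤ, (besselI k.natAbs (β j) / I0) ^ V := by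
    rw [← tsum_mul_left]; exact tsum_congr hD
  rw [hNum, hDen, mul_div_mul_left _ _ (pow_ne_zero _ hI0.ne')]

end Summit.Ventures.LatticeQCDFlow.Scoring
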